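import Summits.QuantumFields.YangMills.Theorems.BalabanUVNodesN07AtRecordFullyPinned

/-!
# BalabanUVNodes ∕ N07 — THE N07 BILL OF K1ᴬ RUNG 1ⱽᵂ (`stub_nodes13PWSVW`, skeleton v11.1 `1c0150ff21ca0f8d`, item stmt-QuantumFields-27239) SERVED BY NAME
# from this lineage's printed-Prop closers at the fully-pinned residual layer `ζ⋆ := ((ζ.pinReg ρ g).withSectEG E G).pinCrit` (`Thm/BalabanUVNodesN07AtRecordFullyPinned`, ✓p480208)

Track A of `YM-PLAN.md` (cell `pub-ymgap`, HUMAN RULING D-0062), DAG node **N07** = [Balaban1985Variational] T. Bałaban, *The variational problem and background fields in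
renormalization group method for lattice gauge theories*, Commun. Math. Phys. **102** (1985) 277–309, Theorem 1 p. 279 and Propositions 2–9 pp. 281–309.  Seat
`pub-ymgap-dag-n07-e` (g38), dag-lead WORDS 657 HANDS (α) «THE N07 BILL OF (Q)»: dag-n24-c g24's share file (Q) `Thm/BalabanUVNodesN24Stub1VWShareK1AxV11` derives the REGISTERED
stub text `∀ F, Inhabited13 F → NodesAtSomeRecord13PWSVW F` from one displayed hypothesis per node («the per-node bills»), ✓p813442; its N07 row reads, in the two landed forms,

  (a) `N24_rung1VW_bodyAt_of_bills_at` (one `F`, the rung's bound `θ`):      `h07 : ∃ ζ : ResidZ F 2, B11Leaf (Z11OfRecord F 2 ζ)`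
  (b) `stub1TextVW_of_bills_atWitnessFamily` (witness family `ι`, every `F`): `h07 : ∀ (F : T4Family) (_ : ι F), ∃ ζ : ResidZ F 2, B11Leaf (Z11OfRecord F 2 ζ)`

— N07's leaf `DagBinding.B11Leaf` at NODE 00's [B11] bundle of record `Node00.Z11OfRecord F 2 ζ` (`Node00/CarriersZ`, node00-def g30) for SOME residual layer `ζ`, exactly the
slot `h07` of the four-pin pointed assembler (dag-n24-c; the bundle does not read the Stage-13 tuple, so the row carries no `θ` and, in form (b), an idle family binder `_ : ι F`).
THIS FILE serves both forms BY NAME from this lineage's printed-Prop closers and says what the row buys.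

WHAT IS PROVED (theorems only, no `def`, 0 sorry).
* §1 THE ROW (b) IS ι-BLIND (kernel form).  `n07Bill_atWitnessFamily_of_forall_exists_b11Leaf`: `(∀ F, ∃ ζ, B11Leaf (Z11OfRecord F 2 ζ)) →` row (b) verbatim, for every family `ι`.
* §2 ROW (a) AT ONE `F` FROM THE PRINTED STATEMENTS (general `N`).  ★ `exists_b11Leaf_Z11OfRecord_of_parts_fullyPinned`: the six printed statements Props 2, 3, 5 (over the
  Sect.-E-presented Props 2–6 family of `(ζ.pinReg ρ g).withSectE E`) and Props 7, 8, Sect. F (over the fully-pinned Props 7–8 family `famXOfRecord F N ζ⋆`, which READ OBJECTS —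
  `N07AtRecordFullyPinned` §1) plus the letters' positivity ⟹ `∃ ζ', B11Leaf (Z11OfRecord F N ζ')`, witnessed by `ζ' := ζ⋆` through this lineage's closer
  `N07AtRecordFullyPinned.b11Leaf_Z11OfRecord_fullyPinned_of_parts` (Prop-7 DAG of print); ★ `exists_b11Leaf_Z11OfRecord_of_towerT_parts_kappa_one_fullyPinned`: the same from
  Props 2, 3, 5, 8, Sect. F + the printed tower's bridge data (Theorem 1 AND Prop. 7 DERIVED by the repaired Sect.-A induction of record, `…_of_towerT_parts_kappa_one`).
* §3 ★★ ROW (b), EVERY `F` AND EVERY FAMILY `ι`, FROM THE PRINTED STATEMENTS (`N = 2`): `n07Bill_atWitnessFamily_of_parts_fullyPinned` — for an `F`-indexed choice of base layer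
  `ζ F`, pin data `ρ F`, `g F` (def-B11's cube class and regularity pin, `CarriersZRegPin`), a Sect.-E presentation `E F` and a Sect.-G presentation `G F`, the six printed statements
  at `ζ⋆ F` and the letters' positivity ⟹ row (b) VERBATIM.  This is the N07 row's price BY NAME: [Balaban1985Variational] Props 2, 3, 5, 7, 8 and Sect. F as printed (T3-class
  content, displayed), the operator data inside the two presentations (readings declared in p462651 ∕ p477837), print's cube class for `g`.
* §4 WHAT THE ROW BUYS (not hollow).  `G8a_of_n07Bill`: row (a) at `F` gives def-B's Stage-₈ letters — solvability `UkExistsR` and orbit uniqueness `UniqueUkOrbitR` of the variational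
  problem (5)–(6) over the (2)-class `regB11`, EVERY approximation `K`, level `k ≤ K`, radius `B₃ε₁`, every datum `V` with (7) (`Node00.G8a_of_b11Leaf_Z11OfRecord`) — i.e. Theorem 1's
  clauses (8) and «uniqueness in (6)» AT NODE 00's no-holes OBJECTS, which no junk residual layer supplies (`Node00/CarriersZ` header: the ∃-form of the leaf «is no longer
  junk-closable»; only its ∀-form is junk-refutable, `Node00.exists_residZ_not_b11Leaf`).

HONEST FRAMING: kernel bookkeeping BY NAME over landed modules (one-line compositions); NOTHING of [Balaban1985Variational] is proved or asserted here — the six printed statements are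
DISPLAYED hypotheses; the N07 row of (Q) is SERVED modulo them, NOT discharged; `stub_nodes13PWSVW` NOT closed; K1ᴬ 0∕6 (never summed across lines); N07 NOT discharged; COUNT 8∕27
(A 8∕28) · K 1∕4 UNMOVED; one finite 𝕋⁴ programme at fixed `ε`, Bałaban AS PRINTED — NOT continuum ∕ ℝ⁴ ∕ OS ∕ mass gap ∕ Clay; the Yang–Mills mass gap is NOT proved by any of this.
No `sorry`, no `def`, no `instance`, no `notation`; standard axioms.  Filed `--kind proof --supports stmt-QuantumFields-27239 --as helper`.
-/

set_option autoImplicit false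

noncomputable section

namespace Summit.QuantumFields.YangMills.BalabanUVNodes.N07BillForStub1VWK1AxV11

open Literature.MathematicalPhysics.QuantumFieldTheory.Balaban1983to89
open Literature.MathematicalPhysics.QuantumFieldTheory.Balaban1983to89.T4Continuum (T4Family)
open Literature.MathematicalPhysics.QuantumFieldTheory.Balaban1983to89.DagBinding
open Literature.MathematicalPhysics.QuantumFieldTheory.Balaban1983to89.Node00
open Summit.QuantumFields.YangMills.BalabanUVNodes.N07AtRecordFullyPinned (b11Leaf_Z11OfRecord_fullyPinned_of_parts
  b11Leaf_Z11OfRecord_fullyPinned_of_towerT_parts_kappa_one)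
open Literature.MathematicalPhysics.QuantumFieldTheory.Balaban1983to89.B12GaugeOrbits021 (OrbitRel)
open Literature.MathematicalPhysics.QuantumFieldTheory.Balaban1983to89.B11Prop7Assembly (Bridge ExistenceLeavesCap)
open scoped Matrix.Norms.L2Operator

/-! ## §1 Row (b) of (Q) is ι-blind -/

/-- **THE N07 ROW (b) OF (Q) FROM THE LEAF, EVERY `F`, EVERY WITNESS FAMILY `ι`** — the row's binder `_ : ι F` is the bill FORMAT of (Q)'s `stub1TextVW_of_bills_atWitnessFamily` (every
node's share is read at the family's members); N07's leaf `B11Leaf (Z11OfRecord F 2 ζ)` does not read the member, so `∀ F, ∃ ζ, B11Leaf (Z11OfRecord F 2 ζ)` gives the row verbatim.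
[cite: Balaban1985Variational, Thm 1 p.279 (bookkeeping: the leaf's carrier bundle is θ-free)] -/
theorem n07Bill_atWitnessFamily_of_forall_exists_b11Leaf (ι : T4Family → Type) (h : ∀ F : T4Family, ∃ ζ : ResidZ F 2, B11Leaf (Z11OfRecord F 2 ζ)) :
    ∀ (F : T4Family) (_ : ι F), ∃ ζ : ResidZ F 2, B11Leaf (Z11OfRecord F 2 ζ) :=
  fun F _ => h F

/-! ## §2 The row at one `F` from the printed statements at the fully-pinned layer `ζ⋆` (general `N`) -/

section OneF

variable {N : ℕ} [NeZero N] {F : T4Family}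
variable {L : ℝ} {η : ZIdx → ℝ} [Fact (0 < L)] [∀ i, Fact (0 < η i)] {β : ZIdx → Type} [∀ i, Fintype (β i)]
variable {𝒴 𝒵 : ZIdx → Type} [∀ i, NormedAddCommGroup (𝒴 i)] [∀ i, NormedSpace ℂ (𝒴 i)] [∀ i, CompleteSpace (𝒴 i)]
  [∀ i, NormedAddCommGroup (𝒵 i)] [∀ i, NormedSpace ℂ (𝒵 i)] [∀ i, CompleteSpace (𝒵 i)]
variable (ζ : ResidZ F N) (ρ : ℝ) (g : ∀ i : ZIdx, RegCubesT F i.K) (E : SectEPres F N L η β (ζ.pinReg ρ g)) (G : SectGPres F N 𝒴 𝒵 (ζ.pinReg ρ g))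

/-- ★ **N07's LEAF FOR SOME RESIDUAL LAYER, FROM SIX PRINTED STATEMENTS** (print's Prop-7 DAG): Props 2, 3, 5 over the Sect.-E-presented Props 2–6 family, Props 7, 8 and Sect. F over
the fully-pinned Props 7–8 family (which READ OBJECTS, `N07AtRecordFullyPinned` §1) and the letters' positivity ⟹ `∃ ζ', B11Leaf (Z11OfRecord F N ζ')`, witnessed by
`ζ' := ((ζ.pinReg ρ g).withSectEG E G).pinCrit` through `N07AtRecordFullyPinned.b11Leaf_Z11OfRecord_fullyPinned_of_parts`.
[cite: Balaban1985Variational, Thm 1 p.279, Prop. 2 p.281, Prop. 3 p.286, Prop. 5 p.293, Prop. 7 p.299, Prop. 8 p.300, Sect. F pp.301–305] -/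
theorem exists_b11Leaf_Z11OfRecord_of_parts_fullyPinned (hC₄ : 0 < E.C₄) (ha₃ : 0 < E.a₃) (hα : 0 < E.α) (hB₀ : 0 < ζ.B₀) (hB₃ : 0 < ζ.B₃) (hC₁ : 0 < ζ.C₁)
    (p2 : B11.Prop2Printed ζ.B₁ ζ.B₃ ζ.C₁ ζ.c₁ ((ζ.pinReg ρ g).withSectE E).famLG)
    (p3 : B11.Prop3Printed ζ.C₁ ζ.B₃ ζ.C₂ ζ.C₃ ζ.B₀ ζ.c1h ζ.c₄ ζ.δ₀ ((ζ.pinReg ρ g).withSectE E).famLG)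
    (p5 : B11.Prop5Printed ζ.B₁ ζ.B₃ ζ.C₁ ((ζ.pinReg ρ g).withSectE E).famLG)
    (p7 : B11.Prop7Printed ζ.B₃ ζ.C₁ (famXOfRecord F N ((ζ.pinReg ρ g).withSectEG E G).pinCrit))
    (p8 : B11.Prop8Printed ζ.B₃ (famXOfRecord F N ((ζ.pinReg ρ g).withSectEG E G).pinCrit))
    (sF : B11.SectFPrinted ζ.B₃ (famXOfRecord F N ((ζ.pinReg ρ g).withSectEG E G).pinCrit)) :
    ∃ ζ' : ResidZ F N, B11Leaf (Z11OfRecord F N ζ') :=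
  ⟨_, b11Leaf_Z11OfRecord_fullyPinned_of_parts ζ ρ g E G hC₄ ha₃ hα hB₀ hB₃ hC₁ p2 p3 p5 p7 p8 sF⟩

/-- ★ **N07's LEAF FOR SOME RESIDUAL LAYER, FROM THE PRINTED TOWER (κ₀ = 1)**: Props 2, 3, 5, 8, Sect. F, the bridge data with its two printed clauses (`hbg14`, `gaugeFix`), the orbit
law `orbit16`, the capped existence leaves and the constant relations ⟹ `∃ ζ', B11Leaf (Z11OfRecord F N ζ')` — Theorem 1 AND Prop. 7 DERIVED by the repaired Sect.-A induction of
record (`N07AtRecordFullyPinned.b11Leaf_Z11OfRecord_fullyPinned_of_towerT_parts_kappa_one`), witness `ζ' := ((ζ.pinReg ρ g).withSectEG E G).pinCrit`.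
[cite: Balaban1985Variational, Thm 1 p.279, Sect. A (11)–(18) pp.279–280, Prop. 2 p.281, Prop. 3 p.286, Prop. 5 p.293, Prop. 8 p.300, Sect. F pp.301–305] -/
theorem exists_b11Leaf_Z11OfRecord_of_towerT_parts_kappa_one_fullyPinned (hC₄ : 0 < E.C₄) (ha₃ : 0 < E.a₃) (hα : 0 < E.α)
    (βr : ∀ i : ZIdx, Bridge (famXOfRecord F N ((ζ.pinReg ρ g).withSectEG E G).pinCrit i) (((ζ.pinReg ρ g).withSectE E).famLG i))
    (bg : ∀ i : ZIdx, GaugeField (F.P i.K) 0 (SU N) → (((ζ.pinReg ρ g).withSectE E).famLG i).Cfg) {O₁ O₂ e₅ : ℝ}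
    (hbg14 : ∀ (i : ZIdx) (ε : ℝ) (V : GaugeField (F.P i.K) i.k (SU N)) (U : GaugeField (F.P i.K) 0 (SU N)),
      InUkClassB11 F N i.K i.k (ζ.C₁ * ζ.B₃ * ε) U → Averaging.iter (avOfRecord F N i.K) i.k U = V →
        (((ζ.pinReg ρ g).withSectE E).famLG i).Sat14 (ζ.C₁ * ζ.B₃ * ε) (ζ.C₁ * ε) ((βr i).bdry V) (bg i U))
    (gaugeFix : ∀ (i : ZIdx) (ε₀ ε₁ : ℝ) (V : GaugeField (F.P i.K) i.k (SU N)) (U₀ : (((ζ.pinReg ρ g).withSectE E).famLG i).Cfg)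
      (U : GaugeField (F.P i.K) 0 (SU N)),
      (((ζ.pinReg ρ g).withSectE E).famLG i).Sat14 (ζ.C₁ * ζ.B₃ * ε₁) (ζ.C₁ * ε₁) ((βr i).bdry V) U₀ → InUkClassB11 F N i.K i.k ε₀ U →
        Averaging.iter (avOfRecord F N i.K) i.k U = V →
          ∃ U' : (((ζ.pinReg ρ g).withSectE E).famLG i).Pert, (((ζ.pinReg ρ g).withSectE E).famLG i).In18 ε₀ ((βr i).bdry V) U₀ U' ∧
            OrbitRel i.k U ((βr i).emb U₀ U') ∧ (IsCritOfRecord F N i.K i.k V U → (((ζ.pinReg ρ g).withSectE E).famLG i).Crit ((βr i).bdry V) U₀ U'))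
    (orbit16 : ∀ (i : ZIdx) (U₀ : (((ζ.pinReg ρ g).withSectE E).famLG i).Cfg) (U₁ : (((ζ.pinReg ρ g).withSectE E).famLG i).Pert)
      (u u' : (((ζ.pinReg ρ g).withSectE E).famLG i).GT),
      (((ζ.pinReg ρ g).withSectE E).famLG i).Restricted U₀ u → (((ζ.pinReg ρ g).withSectE E).famLG i).Restricted U₀ u' →
        OrbitRel i.k ((βr i).emb U₀ ((((ζ.pinReg ρ g).withSectE E).famLG i).toAxial U₀ U₁ u))
          ((βr i).emb U₀ ((((ζ.pinReg ρ g).withSectE E).famLG i).toAxial U₀ U₁ u')))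
    (leaves : ∀ i, ExistenceLeavesCap (βr i) ζ.B₀ ζ.B₃ ζ.C₁ O₁ O₂ e₅)
    (hB₀ : 0 < ζ.B₀) (hB₁ : 0 < ζ.B₁) (hB₃ : 1 ≤ ζ.B₃) (hC₁L : (F.L : ℝ) ^ 3 ≤ ζ.C₁) (hB₀B₁ : ζ.B₀ ≤ 4 * ζ.B₁)
    (hc₁ : 0 < ζ.c₁) (hO₁ : 0 < O₁) (hO₂ : 0 < O₂) (he₅ : 0 < e₅)
    (p2 : B11.Prop2Printed ζ.B₁ ζ.B₃ ζ.C₁ ζ.c₁ ((ζ.pinReg ρ g).withSectE E).famLG)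
    (p3 : B11.Prop3Printed ζ.C₁ ζ.B₃ ζ.C₂ ζ.C₃ ζ.B₀ ζ.c1h ζ.c₄ ζ.δ₀ ((ζ.pinReg ρ g).withSectE E).famLG)
    (p5 : B11.Prop5Printed ζ.B₁ ζ.B₃ ζ.C₁ ((ζ.pinReg ρ g).withSectE E).famLG)
    (p8 : B11.Prop8Printed ζ.B₃ (famXOfRecord F N ((ζ.pinReg ρ g).withSectEG E G).pinCrit))
    (sF : B11.SectFPrinted ζ.B₃ (famXOfRecord F N ((ζ.pinReg ρ g).withSectEG E G).pinCrit)) :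
    ∃ ζ' : ResidZ F N, B11Leaf (Z11OfRecord F N ζ') :=
  ⟨_, b11Leaf_Z11OfRecord_fullyPinned_of_towerT_parts_kappa_one ζ ρ g E G hC₄ ha₃ hα βr bg hbg14 gaugeFix orbit16 leaves hB₀ hB₁ hB₃ hC₁L hB₀B₁ hc₁ hO₁ hO₂ he₅
    p2 p3 p5 p8 sF⟩

end OneF

/-! ## §3 Row (b) of (Q), every `F` and every witness family, from the printed statements (`N = 2`) -/

/-- ★★ **THE N07 ROW (b) OF (Q) FROM [Balaban1985Variational]'s PRINTED PROPOSITIONS 2, 3, 5, 7, 8 AND SECT. F AT THE FULLY-PINNED LAYER, EVERY `F`** (`N = 2`): for an `F`-indexed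
choice of base residual layer `ζ F`, regularity-pin data `ρ F` and cube class `g F` (def-B11's `CarriersZRegPin`), a Sect.-E presentation `E F` (p462651) and a Sect.-G presentation
`G F` (p477837) of the pinned layer, the six printed statements at `ζ⋆ F := (((ζ F).pinReg (ρ F) (g F)).withSectEG (E F) (G F)).pinCrit` and the letters' positivity ⟹ the N07 row
(b) of (Q) VERBATIM for every witness family `ι` (§2 per `F`, §1's ι-blind door); row (a) at one `F` is §2 itself at `N = 2`.  The displayed price of N07's share of `stub_nodes13PWSVW` BY NAME; nothing discharged.
[cite: Balaban1985Variational, Thm 1 p.279, Prop. 2 p.281, Prop. 3 p.286, Prop. 5 p.293, Prop. 7 p.299, Prop. 8 p.300, Sect. F pp.301–305] -/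
theorem n07Bill_atWitnessFamily_of_parts_fullyPinned (ι : T4Family → Type)
    (L : T4Family → ℝ) (η : T4Family → ZIdx → ℝ) [∀ F, Fact (0 < L F)] [∀ F i, Fact (0 < η F i)] (β : T4Family → ZIdx → Type) [∀ F i, Fintype (β F i)]
    (𝒴 𝒵 : T4Family → ZIdx → Type) [∀ F i, NormedAddCommGroup (𝒴 F i)] [∀ F i, NormedSpace ℂ (𝒴 F i)] [∀ F i, CompleteSpace (𝒴 F i)]
    [∀ F i, NormedAddCommGroup (𝒵 F i)] [∀ F i, NormedSpace ℂ (𝒵 F i)] [∀ F i, CompleteSpace (𝒵 F i)]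
    (ζ : ∀ F : T4Family, ResidZ F 2) (ρ : T4Family → ℝ) (g : ∀ (F : T4Family) (i : ZIdx), RegCubesT F i.K)
    (E : ∀ F : T4Family, SectEPres F 2 (L F) (η F) (β F) ((ζ F).pinReg (ρ F) (g F)))
    (G : ∀ F : T4Family, SectGPres F 2 (𝒴 F) (𝒵 F) ((ζ F).pinReg (ρ F) (g F)))
    (hC₄ : ∀ F, 0 < (E F).C₄) (ha₃ : ∀ F, 0 < (E F).a₃) (hα : ∀ F, 0 < (E F).α) (hB₀ : ∀ F, 0 < (ζ F).B₀) (hB₃ : ∀ F, 0 < (ζ F).B₃) (hC₁ : ∀ F, 0 < (ζ F).C₁)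
    (p2 : ∀ F, B11.Prop2Printed (ζ F).B₁ (ζ F).B₃ (ζ F).C₁ (ζ F).c₁ (((ζ F).pinReg (ρ F) (g F)).withSectE (E F)).famLG)
    (p3 : ∀ F, B11.Prop3Printed (ζ F).C₁ (ζ F).B₃ (ζ F).C₂ (ζ F).C₃ (ζ F).B₀ (ζ F).c1h (ζ F).c₄ (ζ F).δ₀ (((ζ F).pinReg (ρ F) (g F)).withSectE (E F)).famLG)
    (p5 : ∀ F, B11.Prop5Printed (ζ F).B₁ (ζ F).B₃ (ζ F).C₁ (((ζ F).pinReg (ρ F) (g F)).withSectE (E F)).famLG)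
    (p7 : ∀ F, B11.Prop7Printed (ζ F).B₃ (ζ F).C₁ (famXOfRecord F 2 (((ζ F).pinReg (ρ F) (g F)).withSectEG (E F) (G F)).pinCrit))
    (p8 : ∀ F, B11.Prop8Printed (ζ F).B₃ (famXOfRecord F 2 (((ζ F).pinReg (ρ F) (g F)).withSectEG (E F) (G F)).pinCrit))
    (sF : ∀ F, B11.SectFPrinted (ζ F).B₃ (famXOfRecord F 2 (((ζ F).pinReg (ρ F) (g F)).withSectEG (E F) (G F)).pinCrit)) :
    ∀ (F : T4Family) (_ : ι F), ∃ ζ : ResidZ F 2, B11Leaf (Z11OfRecord F 2 ζ) :=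
  n07Bill_atWitnessFamily_of_forall_exists_b11Leaf ι fun F =>
    exists_b11Leaf_Z11OfRecord_of_parts_fullyPinned (ζ F) (ρ F) (g F) (E F) (G F) (hC₄ F) (ha₃ F) (hα F) (hB₀ F) (hB₃ F) (hC₁ F)
      (p2 F) (p3 F) (p5 F) (p7 F) (p8 F) (sF F)

/-! ## §4 What the row buys: Theorem 1's (8) and «uniqueness in (6)» at NODE 00's no-holes objects (not hollow) -/

/-- **THE N07 ROW (a) OF (Q) AT ONE `F` GIVES THE STAGE-₈ LETTERS OVER THE (2)-CLASS** — solvability `UkExistsR` (G₈a-1) and orbit uniqueness `UniqueUkOrbitR` (G₈a-2) of the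
variational problem (5)–(6) at `𝓡 := regB11`, EVERY approximation `K`, level `k ≤ K`, radius `B₃ε₁` for `0 < ε₁ ≤ a₁`, every `V` with (7) (`Node00.G8a_of_b11Leaf_Z11OfRecord`, n07-a's
bridge `B11Thm1CarrierTReg.thm1At_socket_gives_G8a`): Theorem 1's clauses (8) and «uniqueness in (6)» AT OBJECTS, which the `t1` conjunct of the leaf carries for EVERY residual layer —
the row is not junk-servable (`Node00/CarriersZ`: the leaf's ∃-form «is no longer junk-closable»). [cite: Balaban1985Variational, Thm 1 p.279, (8) p.279; Balaban1987RG1, (1.1)–(1.2) p.260] -/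
theorem G8a_of_n07Bill {F : T4Family} (h07 : ∃ ζ : ResidZ F 2, B11Leaf (Z11OfRecord F 2 ζ)) :
    ∃ C : B11Thm1.Consts, ∀ (K k : ℕ), k ≤ K → ∀ ε₁ : ℝ, 0 < ε₁ → ε₁ ≤ C.a₁ → ∀ V : GaugeField (F.P K) k (SU 2), PlaqSmall ε₁ V →
      UkExistsR F 2 (regB11 F 2) K k (C.B₃ * ε₁) V ∧ UniqueUkOrbitR F 2 (regB11 F 2) K k (C.B₃ * ε₁) V := by
  obtain ⟨ζ, hζ⟩ := h07
  exact G8a_of_b11Leaf_Z11OfRecord hζ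

end Summit.QuantumFields.YangMills.BalabanUVNodes.N07BillForStub1VWK1AxV11

end
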